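import Summits.AtomisticToContinuum.FouriersLaw.Theorems.ContactStieltjesMeasureStieltjesRepresentationCayleyPencilStieltjesSeries

/-!
# `stub_stieltjesOfPencil`: the Stieltjes representation of a dissipative pencil

Line `cayley-pencil`, crux `StieltjesRepresentation` of route `ContactStieltjesMeasure`, part 5/5.

For `W : ℝ → K →L[ℝ] K` on a real inner-product space with
(R) `W γ f - W γ' f = (γ' - γ) • W γ (W γ' f)` and (E) `⟪f, W γ f⟫ = γ ‖W γ f‖²` (`γ, γ' > 0`), every diagonal
matrix element is a Stieltjes transform in `γ²`:
`⟪g, W γ g⟫ = γ ∫₀^∞ Φ(t) · 2t/(γ²+t²)² dt` with `Φ` monotone, `Φ = 0` on `(-∞, 0]`, `Φ ≤ ‖g‖²`.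

This file: the Cauchy–Stieltjes weight `w_γ(t) = 2t/(γ²+t²)²` and its primitive, the half-angle variable
`s(θ) = √((1 - cos θ)/(1 + cos θ))`, the layer-cake formula `∫ K_γ dρ = γ ∫₀^∞ (ρ'(univ) - ρ'{t ≤ s}) w_γ(t) dt`
(`ρ' = ρ|_{cos ≠ -1}`), and the assembly `exists_stieltjes` / `stub_stieltjesOfPencil` from parts 1–4
(Cayley isometry, Herglotz measure of the moments `⟪C^k g, g⟫`, Poisson resummation).
-/

noncomputable section

open scoped BigOperators Real Topology ENNReal RealInnerProductSpace
open Finset MeasureTheory Filter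

namespace Summit.AtomisticToContinuum.FouriersLaw.Theorems.ContactStieltjesMeasure.CayleyPencil

namespace Stieltjes

open Summit.AtomisticToContinuum.FouriersLaw.Theorems.ContactStieltjesMeasure.CayleyPencil.Algebra
open Summit.AtomisticToContinuum.FouriersLaw.Theorems.ContactStieltjesMeasure.CayleyPencil.Herglotz

variable {K : Type*} [NormedAddCommGroup K] [InnerProductSpace ℝ K] {W : ℝ → K →L[ℝ] K}

/-! ### The layer cake -/

/-- The Cauchy–Stieltjes weight `w_γ(t) = 2t/(γ²+t²)²` is the derivative of `-(γ²+t²)⁻¹`. [folklore] -/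
theorem hasDerivAt_neg_inv {γ : ℝ} (hγ : 0 < γ) (t : ℝ) :
    HasDerivAt (fun t : ℝ => -(γ ^ 2 + t ^ 2)⁻¹) (2 * t / (γ ^ 2 + t ^ 2) ^ 2) t := by
  have hc : HasDerivAt (fun t : ℝ => γ ^ 2 + t ^ 2) (2 * t) t := by
    simpa using ((hasDerivAt_pow 2 t).const_add (γ ^ 2))
  have hne : γ ^ 2 + t ^ 2 ≠ 0 := by positivity
  have h := (hc.inv hne).neg
  have e : -(-(2 * t) / (γ ^ 2 + t ^ 2) ^ 2) = 2 * t / (γ ^ 2 + t ^ 2) ^ 2 := by ring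
  rw [e] at h
  exact h

/-- `∫₀^∞ 2t/(γ²+t²)² dt = (γ²)⁻¹`. [folklore] -/
theorem integral_weight_Ioi {γ : ℝ} (hγ : 0 < γ) :
    ∫ t in Set.Ioi (0:ℝ), 2 * t / (γ ^ 2 + t ^ 2) ^ 2 = (γ ^ 2)⁻¹ := by
  have hlim : Tendsto (fun t : ℝ => -(γ ^ 2 + t ^ 2)⁻¹) atTop (𝓝 0) := by
    have h1 : Tendsto (fun t : ℝ => γ ^ 2 + t ^ 2) atTop atTop :=
      Filter.tendsto_atTop_add_const_left _ _ (tendsto_pow_atTop two_ne_zero)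
    simpa using (tendsto_inv_atTop_zero.comp h1).neg
  rw [integral_Ioi_of_hasDerivAt_of_nonneg (a := 0) ?_ (fun t _ => hasDerivAt_neg_inv hγ t)
    (fun t ht => by have : (0:ℝ) < t := ht; positivity) hlim]
  · simp
  · exact ((hasDerivAt_neg_inv hγ 0).continuousAt).continuousWithinAt

/-- The weight `2t/(γ²+t²)²` is integrable on `(0, ∞)`. [folklore] -/
theorem integrableOn_weight_Ioi {γ : ℝ} (hγ : 0 < γ) :
    IntegrableOn (fun t : ℝ => 2 * t / (γ ^ 2 + t ^ 2) ^ 2) (Set.Ioi 0) := by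
  have hlim : Tendsto (fun t : ℝ => -(γ ^ 2 + t ^ 2)⁻¹) atTop (𝓝 0) := by
    have h1 : Tendsto (fun t : ℝ => γ ^ 2 + t ^ 2) atTop atTop :=
      Filter.tendsto_atTop_add_const_left _ _ (tendsto_pow_atTop two_ne_zero)
    simpa using (tendsto_inv_atTop_zero.comp h1).neg
  exact integrableOn_Ioi_deriv_of_nonneg ((hasDerivAt_neg_inv hγ 0).continuousAt).continuousWithinAt
    (fun t _ => hasDerivAt_neg_inv hγ t) (fun t ht => by have : (0:ℝ) < t := ht; positivity) hlim

/-- `∫₀^s 2t/(γ²+t²)² dt = (γ²)⁻¹ - (γ²+s²)⁻¹`. [folklore] -/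
theorem integral_weight_zero_to {γ : ℝ} (hγ : 0 < γ) (s : ℝ) :
    ∫ t in (0:ℝ)..s, 2 * t / (γ ^ 2 + t ^ 2) ^ 2 = (γ ^ 2)⁻¹ - (γ ^ 2 + s ^ 2)⁻¹ := by
  rw [intervalIntegral.integral_eq_sub_of_hasDerivAt (f := fun t : ℝ => -(γ ^ 2 + t ^ 2)⁻¹)
    (fun t _ => hasDerivAt_neg_inv hγ t)
    (Continuous.intervalIntegrable (Continuous.div (by fun_prop) (by fun_prop)
      (fun t => by positivity)) _ _)]
  simp; ring

/-- The half-angle variable `s(θ) = √((1 - cos θ)/(1 + cos θ))` (`= |tan(θ/2)|`; junk `0` at `cos θ = -1`). [folklore] -/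
def sFn (θ : ℝ) : ℝ := Real.sqrt ((1 - Real.cos θ) / (1 + Real.cos θ))

/-- `0 ≤ s(θ)`. [folklore] -/
theorem sFn_nonneg (θ : ℝ) : 0 ≤ sFn θ := Real.sqrt_nonneg _

/-- `s` is measurable. [folklore] -/
theorem measurable_sFn : Measurable sFn := by
  unfold sFn
  exact (Measurable.div (by fun_prop) (by fun_prop)).sqrt

/-- `s(θ)² = (1 - cos θ)/(1 + cos θ)` off `{cos θ = -1}`. [folklore] -/
theorem sFn_sq {θ : ℝ} (_hθ : Real.cos θ ≠ -1) : sFn θ ^ 2 = (1 - Real.cos θ) / (1 + Real.cos θ) := by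
  unfold sFn
  refine Real.sq_sqrt (div_nonneg ?_ ?_)
  · linarith [Real.cos_le_one θ]
  · linarith [Real.neg_one_le_cos θ]

/-- On `{cos θ ≠ -1}`: `K_γ(θ) = γ ((γ²)⁻¹ - ∫₀^{s(θ)} w_γ) = γ/(γ² + s(θ)²)`. [folklore] -/
theorem poissonFn_eq {γ : ℝ} (hγ : 0 < γ) {θ : ℝ} (hθ : Real.cos θ ≠ -1) :
    poissonFn γ θ = γ * ((γ ^ 2)⁻¹ - ∫ t in (0:ℝ)..sFn θ, 2 * t / (γ ^ 2 + t ^ 2) ^ 2) := by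
  rw [integral_weight_zero_to hγ, sub_sub_cancel, sFn_sq hθ]
  unfold poissonFn
  have h1 : 0 < 1 + Real.cos θ := by
    have := Real.neg_one_le_cos θ
    rcases this.eq_or_lt with h | h
    · exact absurd h.symm hθ
    · linarith
  have hden := poissonFn_den_pos hγ θ
  field_simp

/-- `K_γ(θ) = 0` where `cos θ = -1`. [folklore] -/
theorem poissonFn_eq_zero {γ : ℝ} {θ : ℝ} (hθ : Real.cos θ = -1) : poissonFn γ θ = 0 := by
  unfold poissonFn; rw [hθ]; simp

/-- **Layer cake**: `∫ K_γ dρ = γ ∫₀^∞ (ρ'(univ) - ρ'{t ≤ s}) w_γ(t) dt`, `ρ' = ρ|_{cos ≠ -1}`. [folklore] -/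
theorem integral_poissonFn_eq {γ : ℝ} (hγ : 0 < γ) (ρ : Measure ℝ) [IsFiniteMeasure ρ] :
    ∫ θ, poissonFn γ θ ∂ρ =
      γ * ∫ t in Set.Ioi (0:ℝ),
        ((ρ.restrict {θ | Real.cos θ ≠ -1} Set.univ).toReal -
          (ρ.restrict {θ | Real.cos θ ≠ -1} {θ | t ≤ sFn θ}).toReal) * (2 * t / (γ ^ 2 + t ^ 2) ^ 2) := by
  set G : Set ℝ := {θ | Real.cos θ ≠ -1} with hG
  have hGm : MeasurableSet G := (isOpen_ne.preimage Real.continuous_cos).measurableSet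
  set ρ' : Measure ℝ := ρ.restrict G with hρ'
  haveI : IsFiniteMeasure ρ' := by rw [hρ']; infer_instance
  set w : ℝ → ℝ := fun t => 2 * t / (γ ^ 2 + t ^ 2) ^ 2 with hw
  have hw_nonneg : ∀ t, 0 ≤ t → 0 ≤ w t := fun t ht => by rw [hw]; positivity
  have hw_cont : Continuous w := by
    rw [hw]; exact Continuous.div (by fun_prop) (by fun_prop) (fun t => by positivity)
  -- Step 1: restrict to `G`
  have step1 : ∫ θ, poissonFn γ θ ∂ρ = ∫ θ, poissonFn γ θ ∂ρ' := by
    rw [hρ']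
    refine (setIntegral_eq_integral_of_forall_compl_eq_zero fun θ hθ => ?_).symm
    have : Real.cos θ = -1 := by
      by_contra h; exact hθ h
    exact poissonFn_eq_zero this
  -- Step 2: pointwise identity on `G`
  set I : ℝ → ℝ := fun θ => ∫ t in (0:ℝ)..sFn θ, w t with hI
  have hI_eq : ∀ θ, I θ = (γ ^ 2)⁻¹ - (γ ^ 2 + sFn θ ^ 2)⁻¹ := fun θ => by
    rw [hI]; exact integral_weight_zero_to hγ (sFn θ)
  have hI_nonneg : ∀ θ, 0 ≤ I θ := fun θ => by
    rw [hI_eq, sub_nonneg]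
    exact inv_anti₀ (by positivity) (by nlinarith [sq_nonneg (sFn θ)])
  have hI_le : ∀ θ, I θ ≤ (γ ^ 2)⁻¹ := fun θ => by
    rw [hI_eq]; have : 0 ≤ (γ ^ 2 + sFn θ ^ 2)⁻¹ := by positivity
    linarith
  have hI_meas : Measurable I := by
    have : I = fun θ => (γ ^ 2)⁻¹ - (γ ^ 2 + sFn θ ^ 2)⁻¹ := funext hI_eq
    rw [this]
    exact measurable_const.sub ((measurable_const.add (measurable_sFn.pow_const 2)).inv)
  have step2 : ∫ θ, poissonFn γ θ ∂ρ' = ∫ θ, γ * ((γ ^ 2)⁻¹ - I θ) ∂ρ' := by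
    rw [hρ']
    refine setIntegral_congr_fun hGm fun θ hθ => ?_
    exact poissonFn_eq hγ hθ
  -- Step 3: split
  have hI_int : Integrable I ρ' :=
    (integrable_const ((γ ^ 2)⁻¹)).mono' hI_meas.aestronglyMeasurable
      (Eventually.of_forall fun θ => by
        rw [Real.norm_eq_abs, abs_of_nonneg (hI_nonneg θ)]; exact hI_le θ)
  have step3 : ∫ θ, γ * ((γ ^ 2)⁻¹ - I θ) ∂ρ' = γ * ((ρ' Set.univ).toReal * (γ ^ 2)⁻¹ - ∫ θ, I θ ∂ρ') := by
    rw [integral_const_mul, integral_sub (integrable_const _) hI_int, integral_const, smul_eq_mul,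
      Measure.real]
  -- Step 4: Mathlib's layer cake for `∫ I dρ'`
  have hlayer : ∫ θ, I θ ∂ρ' = ∫ t in Set.Ioi (0:ℝ), (ρ' {θ | t ≤ sFn θ}).toReal * w t := by
    have hL := lintegral_comp_eq_lintegral_meas_le_mul ρ' (f := sFn) (g := w)
      (Eventually.of_forall sFn_nonneg) measurable_sFn.aemeasurable
      (fun t _ => hw_cont.intervalIntegrable _ _)
      ((ae_restrict_iff' measurableSet_Ioi).2 (Eventually.of_forall fun t ht => hw_nonneg t (le_of_lt ht)))
    -- left side as a Bochner integral
    rw [← ofReal_integral_eq_lintegral_ofReal hI_int (Eventually.of_forall hI_nonneg)] at hL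
    -- right side as a Bochner integral
    have hm_anti : Antitone fun t : ℝ => (ρ' {θ | t ≤ sFn θ}).toReal := by
      intro a b hab
      exact ENNReal.toReal_mono (measure_ne_top _ _) (measure_mono fun θ (hθ : b ≤ sFn θ) => hab.trans hθ)
    have hm_meas : Measurable fun t : ℝ => (ρ' {θ | t ≤ sFn θ}).toReal := hm_anti.measurable
    have hm_bdd : ∀ t, (ρ' {θ | t ≤ sFn θ}).toReal ≤ (ρ' Set.univ).toReal := fun t =>
      ENNReal.toReal_mono (measure_ne_top _ _) (measure_mono (Set.subset_univ _))
    have hmw_int : IntegrableOn (fun t => (ρ' {θ | t ≤ sFn θ}).toReal * w t) (Set.Ioi 0) := by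
      refine ((integrableOn_weight_Ioi hγ).const_mul ((ρ' Set.univ).toReal)).mono'
        (hm_meas.mul hw_cont.measurable).aestronglyMeasurable ?_
      refine (ae_restrict_iff' measurableSet_Ioi).2 (Eventually.of_forall fun t ht => ?_)
      have ht : (0:ℝ) < t := ht
      rw [Real.norm_eq_abs, abs_of_nonneg (mul_nonneg ENNReal.toReal_nonneg (hw_nonneg t ht.le))]
      exact mul_le_mul_of_nonneg_right (hm_bdd t) (hw_nonneg t ht.le)
    have hR : ∫⁻ t in Set.Ioi 0, ρ' {θ | t ≤ sFn θ} * ENNReal.ofReal (w t) =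
        ENNReal.ofReal (∫ t in Set.Ioi (0:ℝ), (ρ' {θ | t ≤ sFn θ}).toReal * w t) := by
      rw [ofReal_integral_eq_lintegral_ofReal hmw_int]
      · refine setLIntegral_congr_fun measurableSet_Ioi fun t ht => ?_
        have ht : (0:ℝ) < t := ht
        rw [ENNReal.ofReal_mul ENNReal.toReal_nonneg, ENNReal.ofReal_toReal (measure_ne_top _ _)]
      · refine (ae_restrict_iff' measurableSet_Ioi).2 (Eventually.of_forall fun t ht => ?_)
        have ht : (0:ℝ) < t := ht
        exact mul_nonneg ENNReal.toReal_nonneg (hw_nonneg t ht.le)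
    rw [hR] at hL
    have hA : 0 ≤ ∫ θ, I θ ∂ρ' := integral_nonneg hI_nonneg
    have hB : 0 ≤ ∫ t in Set.Ioi (0:ℝ), (ρ' {θ | t ≤ sFn θ}).toReal * w t :=
      setIntegral_nonneg measurableSet_Ioi fun t ht => mul_nonneg ENNReal.toReal_nonneg (hw_nonneg t (le_of_lt ht))
    exact (ENNReal.ofReal_eq_ofReal_iff hA hB).1 hL
  -- Step 5: assemble
  rw [step1, step2, step3, hlayer]
  congr 1
  have hm_anti : Antitone fun t : ℝ => (ρ' {θ | t ≤ sFn θ}).toReal := by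
    intro a b hab
    exact ENNReal.toReal_mono (measure_ne_top _ _) (measure_mono fun θ (hθ : b ≤ sFn θ) => hab.trans hθ)
  have hm_meas : Measurable fun t : ℝ => (ρ' {θ | t ≤ sFn θ}).toReal := hm_anti.measurable
  have hm_bdd : ∀ t, (ρ' {θ | t ≤ sFn θ}).toReal ≤ (ρ' Set.univ).toReal := fun t =>
    ENNReal.toReal_mono (measure_ne_top _ _) (measure_mono (Set.subset_univ _))
  have hmw_int : IntegrableOn (fun t => (ρ' {θ | t ≤ sFn θ}).toReal * w t) (Set.Ioi 0) := by
    refine ((integrableOn_weight_Ioi hγ).const_mul ((ρ' Set.univ).toReal)).mono'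
      (hm_meas.mul hw_cont.measurable).aestronglyMeasurable ?_
    refine (ae_restrict_iff' measurableSet_Ioi).2 (Eventually.of_forall fun t ht => ?_)
    have ht : (0:ℝ) < t := ht
    rw [Real.norm_eq_abs, abs_of_nonneg (mul_nonneg ENNReal.toReal_nonneg (hw_nonneg t ht.le))]
    exact mul_le_mul_of_nonneg_right (hm_bdd t) (hw_nonneg t ht.le)
  have e : (fun t => ((ρ' Set.univ).toReal - (ρ' {θ | t ≤ sFn θ}).toReal) * w t) =
      fun t => (ρ' Set.univ).toReal * w t - (ρ' {θ | t ≤ sFn θ}).toReal * w t := by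
    funext t; ring
  rw [e, integral_sub ((integrableOn_weight_Ioi hγ).const_mul _) hmw_int, integral_const_mul,
    integral_weight_Ioi hγ]

/-! ### The representation -/

/-- **`stub_stieltjesOfPencil`, general form**: for a dissipative pencil every diagonal matrix element is
`γ ∫₀^∞ Φ(t) 2t/(γ²+t²)² dt` with `Φ` monotone, vanishing on `(-∞,0]`, bounded by `‖g‖²`. [folklore] -/
theorem exists_stieltjes
    (hR : ∀ γ γ' : ℝ, 0 < γ → 0 < γ' → ∀ f : K, W γ f - W γ' f = (γ' - γ) • W γ (W γ' f))
    (hE : ∀ γ : ℝ, 0 < γ → ∀ f : K, inner ℝ f (W γ f) = γ * ‖W γ f‖ ^ 2)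
    (g : K) :
    ∃ Φ : ℝ → ℝ, Monotone Φ ∧ (∀ s : ℝ, s ≤ 0 → Φ s = 0) ∧ (∀ s : ℝ, Φ s ≤ ‖g‖ ^ 2) ∧
      ∀ γ : ℝ, 0 < γ →
        inner ℝ g (W γ g) = γ * ∫ t in Set.Ioi (0 : ℝ), Φ t * (2 * t / (γ ^ 2 + t ^ 2) ^ 2) := by
  obtain ⟨ρ, hfin, hmass, hmom⟩ := exists_measure_of_toeplitzPSD (toeplitzPSD_momentSeq hE g)
  haveI := hfin
  set ρ' : Measure ℝ := ρ.restrict {θ | Real.cos θ ≠ -1} with hρ'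
  haveI : IsFiniteMeasure ρ' := by rw [hρ']; infer_instance
  have hρ'univ : (ρ' Set.univ).toReal ≤ ‖g‖ ^ 2 := by
    have h1 : ρ' Set.univ ≤ ρ Set.univ := by
      rw [hρ', Measure.restrict_apply_univ]; exact measure_mono (Set.subset_univ _)
    have h2 : (ρ Set.univ).toReal = ‖g‖ ^ 2 := by
      rw [hmass, momentSeq_zero, ENNReal.toReal_ofReal (by positivity)]
    rw [← h2]
    exact ENNReal.toReal_mono (measure_ne_top _ _) h1
  refine ⟨fun t => if 0 < t then (ρ' Set.univ).toReal - (ρ' {θ | t ≤ sFn θ}).toReal else 0,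
    ?_, ?_, ?_, ?_⟩
  · -- monotone
    intro a b hab
    by_cases hb : 0 < b
    · by_cases ha : 0 < a
      · simp only [if_pos ha, if_pos hb]
        have : (ρ' {θ | b ≤ sFn θ}).toReal ≤ (ρ' {θ | a ≤ sFn θ}).toReal :=
          ENNReal.toReal_mono (measure_ne_top _ _) (measure_mono fun θ (hθ : b ≤ sFn θ) => hab.trans hθ)
        linarith
      · simp only [if_neg ha, if_pos hb, sub_nonneg]
        exact ENNReal.toReal_mono (measure_ne_top _ _) (measure_mono (Set.subset_univ _))
    · have ha : ¬ 0 < a := fun h => hb (lt_of_lt_of_le h hab)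
      simp only [if_neg ha, if_neg hb, le_refl]
  · -- vanishing on `(-∞, 0]`
    intro s hs
    simp only [if_neg (not_lt.2 hs)]
  · -- bounded by `‖g‖²`
    intro s
    by_cases hs : 0 < s
    · simp only [if_pos hs]
      have : 0 ≤ (ρ' {θ | s ≤ sFn θ}).toReal := ENNReal.toReal_nonneg
      linarith
    · simp only [if_neg hs]; positivity
  · -- the representation
    intro γ hγ
    rw [inner_eq_integral_poissonFn hR hE hγ g hmom, integral_poissonFn_eq hγ ρ]
    congr 1
    refine setIntegral_congr_fun measurableSet_Ioi fun t ht => ?_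
    have ht : (0:ℝ) < t := ht
    simp only [if_pos ht, hρ']

end Stieltjes

/-! ### The registered stub, by name and signature -/

/-- **`stub_stieltjesOfPencil`** (line `cayley-pencil`, crux `StieltjesRepresentation`): for a dissipative pencil
(R) + (E) on a real inner-product space, every diagonal matrix element `⟪g, W γ g⟫` equals
`γ ∫₀^∞ Φ(t) · 2t/(γ²+t²)² dt` with `Φ` monotone, vanishing on `(-∞, 0]` and bounded by `‖g‖²`
(Cayley transform isometry, Herglotz's theorem for `⟪C^k g, g⟫`, Poisson resummation, layer cake).
[cite: LaxPhillips1967, Ch. II §3] [cite: Katznelson2004, Ch. I §7] [folklore] -/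
theorem stub_stieltjesOfPencil :
    ∀ (K : Type) [NormedAddCommGroup K] [InnerProductSpace ℝ K] (W : ℝ → K →L[ℝ] K),
      (∀ γ γ' : ℝ, 0 < γ → 0 < γ' → ∀ f : K, W γ f - W γ' f = (γ' - γ) • W γ (W γ' f)) →
      (∀ γ : ℝ, 0 < γ → ∀ f : K, inner ℝ f (W γ f) = γ * ‖W γ f‖ ^ 2) →
      ∀ g : K, ∃ Φ : ℝ → ℝ, Monotone Φ ∧ (∀ s : ℝ, s ≤ 0 → Φ s = 0) ∧ (∀ s : ℝ, Φ s ≤ ‖g‖ ^ 2) ∧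
        ∀ γ : ℝ, 0 < γ →
          inner ℝ g (W γ g) = γ * ∫ t in Set.Ioi (0 : ℝ), Φ t * (2 * t / (γ ^ 2 + t ^ 2) ^ 2) := by
  intro K _ _ W hR hE g
  exact Stieltjes.exists_stieltjes hR hE g

end Summit.AtomisticToContinuum.FouriersLaw.Theorems.ContactStieltjesMeasure.CayleyPencil

end
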